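import Mathlib
import HarnessLib
import Literature.Computability.AlgebraicComplexity.KRSTDesign
import Literature.Computability.AlgebraicComplexity.ValiantClasses
import Literature.Barriers.ValiantsHypothesis.CT23LowerBoundsFromSuccinctHittingSets
import Summits.ValiantsHypothesis.ValiantsHypothesis.Theorems.DefinabilityGapAffineRung

/-!
# DefinabilityGap — the p-FAMILY rung of K2c (kernel, unconditional)
# (support for `KIAnnihilatorDefinableOnCollapse`, item `stmt-ValiantsHypothesis-23546`)

Support for route `route-ValiantsHypothesis-DefinabilityGap` (decomp-valiant lens 5, gen 2; the writer's tribunal `--quick`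
asked for "a proved rung OF K2c"). The attacked crux K2c reads

  `VP = VNP → ∃ A : ∀ m, ℂ[z_c : c ∈ 𝔽_q³],  IsVNPFamily A ∧ ∃ m₁, ∀ m ≥ m₁, A m ≠ 0 ∧ A m ∘ G_m = 0`,

and `IsVNPFamily A = IsPFamily A ∧ (A is a Boolean sum of a VP family)` (tree `IsVNPFamily`, `IsPFamily` = p-bounded
number of variables and p-bounded degree). FIRST RUNG, proved here WITHOUT the collapse hypothesis: the annihilator family
exists as a p-FAMILY —

* `k2c_pFamily_rung : ∃ A, IsPFamily A ∧ ∃ m₁, ∀ m ≥ m₁, A m ≠ 0 ∧ bind₁ (kiPer m) (A m) = 0`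

(literally K2c's conclusion with `IsVNPFamily` truncated to its first conjunct `IsPFamily`; `k2c_conclusion_to_rung` records the
truncation). Mechanism = the K2 lever of the route (parameter counting on the planted generator: `q³` outputs of degree `≤ m`
in `q²` seed variables, `q³ ≥ 2q²`; Chatterjee–Tengse 2023 Lemma 3.2 = tree `exists_annihilator_degreeOf_le_of_two_mul_le`),
giving individual degrees `≤ q³·m` hence total degree `≤ q⁶·m`, p-bounded since `q(m) ≤ 2(m²+1)`. What separates the rung from
K2c is exactly DEFINABILITY of one such family (coefficients as a `VNP` = `#P`-type sum) — in print one notch up the same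
ladder: an annihilator family in uniform `VPSPACE⁰_b` (Chatterjee–Tengse 2023, Lemma 4.7), and K2c asks `VNP` under `VP = VNP`.
`S` (VP ≠ VNP) is silent about annihilators of `G_m`, so the rung is not inside S's known regime.
-/

noncomputable section

open MvPolynomial
open Literature.Computability.AlgebraicComplexity Literature.Computability.MetaComplexity
open Summit.ValiantsHypothesis.ValiantsHypothesis.Theorems.DefinabilityGapAffineRung (qOf qOf_spec sq_le_qOf kiPer)

namespace Summit.ValiantsHypothesis.ValiantsHypothesis.Theorems.DefinabilityGapK2cPFamilyRung

/-- Powers of `q(m)` are p-bounded (`q(m) ≤ 2(m²+1)`, Bertrand via `leastPrimeGe_le`). [folklore] -/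
theorem isPBounded_qOf_pow (k : ℕ) : IsPBounded fun m => qOf m ^ k := by
  have hq : IsPBounded qOf := by
    refine IsPBounded.mono (t := fun m => 2 * (m * m + 1)) ?_ (fun m => leastPrimeGe_le _ (by omega))
    exact IsPBounded.mul_holds (IsPBounded.const 2)
      (IsPBounded.add_holds (IsPBounded.mul_holds IsPBounded.id IsPBounded.id) (IsPBounded.const 1))
  exact IsPBounded.pow_holds hq k

/-- Total degree from individual degrees: `deg A ≤ #σ · max_j deg_j A`. [folklore] -/
theorem totalDegree_le_card_mul_of_degreeOf_le {R : Type*} [CommSemiring R] {σ : Type*} [Fintype σ]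
    {A : MvPolynomial σ R} {d : ℕ} (h : ∀ j, A.degreeOf j ≤ d) :
    A.totalDegree ≤ Fintype.card σ * d := by
  classical
  rw [totalDegree]
  refine Finset.sup_le fun s hs => ?_
  calc (s.sum fun _ e => e) = ∑ j ∈ s.support, s j := rfl
    _ ≤ ∑ j, s j :=
        Finset.sum_le_sum_of_subset_of_nonneg (Finset.subset_univ _) (fun _ _ _ => Nat.zero_le _)
    _ ≤ ∑ _j : σ, d := Finset.sum_le_sum fun j _ => (monomial_le_degreeOf j hs).trans (h j)
    _ = Fintype.card σ * d := by simp

/-- **Annihilators of `G_m` exist with individual degree `≤ q³·m`** (KERNEL, unconditional; Chatterjee–Tengse 2023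
Lemma 3.2 = tree `exists_annihilator_degreeOf_le_of_two_mul_le`, instantiated on the planted generator: `q³` outputs of
degree `≤ m` in `q²` seed variables). [cite: ChatterjeeTengse2023, Lemma 3.2] -/
theorem kiPer_annihilator_exists (m : ℕ) (hm : 1 ≤ m) :
    ∃ A : MvPolynomial (Fin 3 → Fin (qOf m)) ℂ, A ≠ 0 ∧ (∀ j, A.degreeOf j ≤ qOf m ^ 3 * m) ∧
      bind₁ (kiPer m) A = 0 := by
  classical
  have hq2 : 2 ≤ qOf m := (qOf_spec m).2.two_le
  -- transport to `Fin`-indexed inputs/outputs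
  let eo : (Fin 3 → Fin (qOf m)) ≃ Fin (qOf m ^ 3) := finFunctionFinEquiv
  let ei : Fin (qOf m) × Fin (qOf m) ≃ Fin (qOf m * qOf m) := finProdFinEquiv
  let G' : Fin (qOf m ^ 3) → MvPolynomial (Fin (qOf m * qOf m)) ℂ :=
    fun i => rename ei (kiPer m (eo.symm i))
  have hdeg : ∀ i, (G' i).totalDegree ≤ m := by
    intro i
    refine (totalDegree_rename_le _ _).trans ?_
    rw [kiPer, kiGenerator_apply]
    exact (totalDegree_rename_le _ _).trans (totalDegree_perPad_le (sq_le_qOf m))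
  have hin : 1 ≤ qOf m * qOf m := Nat.one_le_iff_ne_zero.2 (Nat.mul_ne_zero (by omega) (by omega))
  have hn : 2 * (qOf m * qOf m) ≤ qOf m ^ 3 := by
    calc 2 * (qOf m * qOf m) ≤ qOf m * (qOf m * qOf m) := Nat.mul_le_mul_right _ hq2
      _ = qOf m ^ 3 := by ring
  obtain ⟨A', hA'0, hA'deg, hA'⟩ :=
    Literature.Barriers.ValiantsHypothesis.exists_annihilator_degreeOf_le_of_two_mul_le (K := ℂ) hin hm hn G' hdeg
  refine ⟨rename eo.symm A', ?_, fun j => ?_, ?_⟩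
  · intro h
    exact hA'0 (rename_injective _ eo.symm.injective (by rw [h, map_zero]))
  · have := hA'deg (eo j)
    rw [← degreeOf_rename_of_injective eo.symm.injective (eo j), Equiv.symm_apply_apply] at this
    exact this.trans (by nlinarith [hdeg (eo j)])
  · have h1 : bind₁ (kiPer m) (rename eo.symm A') = bind₁ (fun i => kiPer m (eo.symm i)) A' :=
      bind₁_rename _ _ _
    have h2 : rename ei (bind₁ (fun i => kiPer m (eo.symm i)) A') = aeval G' A' := by
      rw [rename_bind₁]; rfl
    rw [h1]
    exact rename_injective _ ei.injective (by rw [h2, hA', map_zero])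

/-- **The p-family rung of K2c** (KERNEL, unconditional): there is a family `(A_m)` of annihilators of the planted
generators `G_m`, nonzero for every `m ≥ 1`, which is a p-FAMILY (`q(m)³` variables, total degree `≤ q(m)⁶·m`, both
p-bounded) — K2c's conclusion with `IsVNPFamily` truncated to `IsPFamily`, and no collapse hypothesis.
[cite: ChatterjeeTengse2023, Lemma 3.2 (existence with degree bound), Lemma 4.7 (the next rung: VPSPACE⁰_b)] -/
theorem k2c_pFamily_rung :
    ∃ A : ∀ m : ℕ, MvPolynomial (Fin 3 → Fin (qOf m)) ℂ,
      IsPFamily A ∧ ∃ m₁, ∀ m, m₁ ≤ m → A m ≠ 0 ∧ bind₁ (kiPer m) (A m) = 0 := by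
  classical
  have hex : ∀ m : ℕ, ∃ A : MvPolynomial (Fin 3 → Fin (qOf m)) ℂ,
      (∀ j, A.degreeOf j ≤ qOf m ^ 3 * m) ∧ (1 ≤ m → A ≠ 0 ∧ bind₁ (kiPer m) A = 0) := by
    intro m
    by_cases hm : 1 ≤ m
    · obtain ⟨A, hA0, hdeg, hann⟩ := kiPer_annihilator_exists m hm
      exact ⟨A, hdeg, fun _ => ⟨hA0, hann⟩⟩
    · exact ⟨0, fun j => by rw [degreeOf_zero]; exact Nat.zero_le _, fun h => absurd h hm⟩
  choose A hAdeg hA using hex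
  refine ⟨A, ⟨?_, ?_⟩, 1, fun m hm => hA m hm⟩
  · -- p-bounded number of variables: `q(m)³`
    refine IsPBounded.mono (t := fun m => qOf m ^ 3) (isPBounded_qOf_pow 3) fun m => ?_
    simp [Fintype.card_fin]
  · -- p-bounded total degree: `≤ q³ · (q³ m)`
    refine IsPBounded.mono (t := fun m => qOf m ^ 3 * (qOf m ^ 3 * m))
      (IsPBounded.mul_holds (isPBounded_qOf_pow 3)
        (IsPBounded.mul_holds (isPBounded_qOf_pow 3) IsPBounded.id)) fun m => ?_
    refine (totalDegree_le_card_mul_of_degreeOf_le (hAdeg m)).trans (le_of_eq ?_)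
    simp [Fintype.card_fin]

/-- The rung IS a truncation of K2c's conclusion: a `VNP` annihilator family is in particular a p-family of annihilators
(`IsVNPFamily A → IsPFamily A` is the first projection). [cite: Burgisser2000, Def. 2.4, Def. 2.8] -/
theorem k2c_conclusion_to_rung {A : ∀ m : ℕ, MvPolynomial (Fin 3 → Fin (qOf m)) ℂ}
    (h : IsVNPFamily A ∧ ∃ m₁, ∀ m, m₁ ≤ m → A m ≠ 0 ∧ bind₁ (kiPer m) (A m) = 0) :
    IsPFamily A ∧ ∃ m₁, ∀ m, m₁ ≤ m → A m ≠ 0 ∧ bind₁ (kiPer m) (A m) = 0 :=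
  ⟨h.1.1, h.2⟩

end Summit.ValiantsHypothesis.ValiantsHypothesis.Theorems.DefinabilityGapK2cPFamilyRung

end
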